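import Mathlib
import Summits.NavierStokesRegularity.NavierStokesRegularity.Theses.PlaneEnergyCeiling
import Summits.NavierStokesRegularity.NavierStokesRegularity.Theorems.PlaneEnergyCeilingPlanarEnergyAPrioriPlanarAgmon
import Summits.NavierStokesRegularity.NavierStokesRegularity.Theorems.PlaneEnergyCeilingBoundedPlanarEnergyRegularityStubRieszCeiling

/-!
# Route PlaneEnergyCeiling · crux `PlanarEnergyAPriori` — a planar ceiling is a Hardy ceiling

Helper file for the crux item stmt-NavierStokesRegularity-16855 (`PlanarEnergyAPriori`, route
`PlaneEnergyCeiling`), landed `--supports` that item. It proves the kinematic FIRST LEMMA of the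
crux idea `hardy-average-transfer` (`Cruxes/PlanarEnergyAPriori/Ideas/hardy-average-transfer.md`,
Sketch `PlanarCeilingImpliesHardy`): if a continuous field `w` on `ℝ³` has planar energy `≤ M`
through EVERY plane `R({x₂ = c})`, then the Newtonian (Hardy) potential of `|w|²` is bounded by
`2M` at every centre,
`∫ |w(y)|² / |y − x₀| dy ≤ 2M` for all `x₀ ∈ ℝ³`,
and the two calibrations the card draws from it:

* `hardyCeiling_of_planarBound` — along a classical solution, a planar bound on `[0,T)` is a Hardy
  bound on `[0,T)` (uniform in the centre);
* `PlanarEnergyAPriori.globalHardyCeiling` / `globalHardyCeiling_of_planarEnergyAPriori` — GIVEN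
  the crux, every classical Leray–Hopf solution from a rapidly decaying datum obeys a GLOBAL HARDY
  CEILING `sup_{t<T} sup_{x₀} ∫|u(t,y)|²/|y−x₀| dy < ∞` (the card's stub A `GlobalHardyCeiling`,
  the global parent of route HardyPointSink's crux `HardyEnergyBound`); so the crux is at least as
  strong as the Hardy ceiling, which in turn contains Seregin's Type-I-in-energy bound
  (`lintegral_ball_le_of_hardy`: `∫_{B_r(x₀)}|w|² ≤ r · ∫|w|²/|y−x₀|`).

Proof of the first lemma: a planar bound through all planes with unit normal `e` integrates
(Tonelli along the normal foliation, `lintegral_eq_lintegral_lintegral_normalLine` with the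
Householder reflection taking `e₂` to `e`) to the slab bound `∫_{c−δ<⟪y,e⟫<c+δ}|w|² ≤ 2δM` in every
direction, and the Radon back-projection inequality `stub_rieszCeiling` (landed for the sibling
crux `BoundedPlanarEnergyRegularity`) turns slab bounds in all directions into the Hardy bound.
Folklore (Helgason, *Geometric Analysis on Symmetric Spaces*, Ch. I, Thm. 2.1, `n = 3`).
-/

noncomputable section

-- single-conjunct summit: `Summit.<Summit>.<Problem>` repeats the name by the D-0017 layout
set_option linter.dupNamespace false

namespace Summit.NavierStokesRegularity.NavierStokesRegularity.Theorems.PlanarEnergyAPriori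

open MeasureTheory Set Filter Topology WithLp Metric
open scoped ENNReal RealInnerProductSpace
open Literature.Analysis.FluidPDE
open Summit.NavierStokesRegularity.NavierStokesRegularity.Theorems.BoundedPlanarEnergyRegularity
  (stub_rieszCeiling)

/-- For a unit vector `e` of `ℝ³` there is a linear isometry of `ℝ³` taking the coordinate vector
`e₂` to `e` (the Householder reflection in the bisector). -/
theorem exists_linearIsometryEquiv_apply_single_two {e : EuclideanSpace ℝ (Fin 3)} (he : ‖e‖ = 1) :
    ∃ R : EuclideanSpace ℝ (Fin 3) ≃ₗᵢ[ℝ] EuclideanSpace ℝ (Fin 3), R (EuclideanSpace.single 2 1) = e := by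
  refine ⟨Submodule.reflection (ℝ ∙ (EuclideanSpace.single 2 (1 : ℝ) - e))ᗮ, Submodule.reflection_sub ?_⟩
  rw [he]
  simp

/-- The height of the chart point `R(y₀, y₁, s)` above the plane `R({x₂ = 0})`, measured along the
unit normal `R e₂`, is `s`. -/
theorem inner_chart_normal (R : EuclideanSpace ℝ (Fin 3) ≃ₗᵢ[ℝ] EuclideanSpace ℝ (Fin 3))
    (y : EuclideanSpace ℝ (Fin 2)) (s : ℝ) :
    ⟪R (toLp 2 ![y 0, y 1, s]), R (EuclideanSpace.single 2 1)⟫ = s := by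
  rw [LinearIsometryEquiv.inner_map_map, EuclideanSpace.inner_single_right]
  simp

/-- **Slab energies from planar energies, in every direction.** If a continuous field `w` has
planar energy `≤ M'` through every plane `R({x₂ = c})`, then for every unit `e`, offset `c` and
half-width `δ` the energy in the slab `{c − δ < ⟪y,e⟫ < c + δ}` is at most `2δ · M'`. -/
theorem lintegral_dirSlab_le_of_planar {F : Type*} [NormedAddCommGroup F]
    {w : EuclideanSpace ℝ (Fin 3) → F} (hw : Continuous w) {M' : ℝ≥0∞}
    (hpl : ∀ (R : EuclideanSpace ℝ (Fin 3) ≃ₗᵢ[ℝ] EuclideanSpace ℝ (Fin 3)) (c : ℝ),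
      ∫⁻ y : EuclideanSpace ℝ (Fin 2), ‖w (R (toLp 2 ![y 0, y 1, c]))‖ₑ ^ 2 ≤ M')
    {e : EuclideanSpace ℝ (Fin 3)} (he : ‖e‖ = 1) (c δ : ℝ) :
    ∫⁻ y in {y : EuclideanSpace ℝ (Fin 3) | c - δ < ⟪y, e⟫ ∧ ⟪y, e⟫ < c + δ}, ‖w y‖ₑ ^ 2 ≤
      ENNReal.ofReal (2 * δ) * M' := by
  obtain ⟨R, hR⟩ := exists_linearIsometryEquiv_apply_single_two he
  set S : Set (EuclideanSpace ℝ (Fin 3)) := {y | c - δ < ⟪y, e⟫ ∧ ⟪y, e⟫ < c + δ} with hS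
  have hSm : MeasurableSet S := by
    have hc : Continuous fun y : EuclideanSpace ℝ (Fin 3) => ⟪y, e⟫ := continuous_id.inner continuous_const
    exact (measurableSet_lt measurable_const hc.measurable).inter
      (measurableSet_lt hc.measurable measurable_const)
  set f : EuclideanSpace ℝ (Fin 3) → ℝ≥0∞ := S.indicator fun y => ‖w y‖ₑ ^ 2 with hf
  have hfm : Measurable f := ((continuous_enorm.comp hw).measurable.pow_const 2).indicator hSm
  -- along the normal lines of the foliation `R`, the indicator of `S` is the indicator of `(c-δ, c+δ)`
  have hline : ∀ (y : EuclideanSpace ℝ (Fin 2)) (s : ℝ),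
      f (R (toLp 2 ![y 0, y 1, s])) =
        (Ioo (c - δ) (c + δ)).indicator (fun s => ‖w (R (toLp 2 ![y 0, y 1, s]))‖ₑ ^ 2) s := by
    intro y s
    have hmem : (R (toLp 2 ![y 0, y 1, s]) ∈ S) ↔ s ∈ Ioo (c - δ) (c + δ) := by
      simp only [hS, mem_setOf_eq, mem_Ioo, ← hR, inner_chart_normal]
    by_cases hs : s ∈ Ioo (c - δ) (c + δ)
    · rw [hf, indicator_of_mem (hmem.2 hs), indicator_of_mem hs]
    · rw [hf, indicator_of_notMem (fun h => hs (hmem.1 h)), indicator_of_notMem hs]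
  have hmeas2 : Measurable fun q : EuclideanSpace ℝ (Fin 2) × ℝ =>
      ‖w (R (toLp 2 ![q.1 0, q.1 1, q.2]))‖ₑ ^ 2 := by
    have hc : Continuous fun q : EuclideanSpace ℝ (Fin 2) × ℝ =>
        (toLp 2 ![q.1 0, q.1 1, q.2] : EuclideanSpace ℝ (Fin 3)) := by
      fun_prop
    exact (continuous_enorm.comp (hw.comp (R.continuous.comp hc))).measurable.pow_const 2
  calc ∫⁻ y in S, ‖w y‖ₑ ^ 2 = ∫⁻ y, f y := (lintegral_indicator hSm _).symm
    _ = ∫⁻ y : EuclideanSpace ℝ (Fin 2), ∫⁻ s : ℝ, f (R (toLp 2 ![y 0, y 1, s])) :=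
        lintegral_eq_lintegral_lintegral_normalLine hfm R
    _ = ∫⁻ y : EuclideanSpace ℝ (Fin 2), ∫⁻ s in Ioo (c - δ) (c + δ),
          ‖w (R (toLp 2 ![y 0, y 1, s]))‖ₑ ^ 2 := by
        simp only [hline, lintegral_indicator measurableSet_Ioo]
    _ = ∫⁻ s in Ioo (c - δ) (c + δ), ∫⁻ y : EuclideanSpace ℝ (Fin 2),
          ‖w (R (toLp 2 ![y 0, y 1, s]))‖ₑ ^ 2 := by
        rw [lintegral_lintegral_swap]
        exact hmeas2.aemeasurable
    _ ≤ ∫⁻ _ in Ioo (c - δ) (c + δ), M' := setLIntegral_mono' measurableSet_Ioo fun s _ => hpl R s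
    _ = ENNReal.ofReal (2 * δ) * M' := by
        rw [setLIntegral_const, Real.volume_Ioo, mul_comm]
        congr 2
        ring

/-- **A planar ceiling is a Hardy ceiling** (first lemma of the idea `hardy-average-transfer`). If a
continuous field `w` on `ℝ³` has planar energy `≤ M` through every plane `R({x₂ = c})`, then
`∫ |w(y)|²/|y − x₀| dy ≤ 2M` for every centre `x₀` (slab bounds in every direction, then the Radon
back-projection inequality `stub_rieszCeiling`). [folklore; Helgason, Geometric Analysis on
Symmetric Spaces, Ch. I Thm. 2.1] -/
theorem hardyCeiling_of_planarCeiling {w : EuclideanSpace ℝ (Fin 3) → EuclideanSpace ℝ (Fin 3)}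
    (hw : Continuous w) {M : ℝ} (hM : 0 ≤ M)
    (hpl : ∀ (R : EuclideanSpace ℝ (Fin 3) ≃ₗᵢ[ℝ] EuclideanSpace ℝ (Fin 3)) (c : ℝ),
      ∫⁻ y : EuclideanSpace ℝ (Fin 2), ‖w (R (toLp 2 ![y 0, y 1, c]))‖ₑ ^ 2 ≤ ENNReal.ofReal M)
    (x₀ : EuclideanSpace ℝ (Fin 3)) :
    ∫⁻ y, ‖w y‖ₑ ^ 2 / ‖y - x₀‖ₑ ≤ ENNReal.ofReal (2 * M) := by
  have hslab : ∀ (e : EuclideanSpace ℝ (Fin 3)), ‖e‖ = 1 → ∀ (c δ : ℝ), 0 < δ →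
      ∫⁻ y in {y : EuclideanSpace ℝ (Fin 3) | c - δ < inner ℝ y e ∧ inner ℝ y e < c + δ},
        ‖w y‖ₑ ^ 2 ≤ ENNReal.ofReal (2 * δ * M) := by
    intro e he c δ hδ
    calc ∫⁻ y in {y : EuclideanSpace ℝ (Fin 3) | c - δ < inner ℝ y e ∧ inner ℝ y e < c + δ}, ‖w y‖ₑ ^ 2
        ≤ ENNReal.ofReal (2 * δ) * ENNReal.ofReal M := lintegral_dirSlab_le_of_planar hw hpl he c δ
      _ = ENNReal.ofReal (2 * δ * M) := by rw [← ENNReal.ofReal_mul (by positivity)]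
  have h := stub_rieszCeiling w hw.aestronglyMeasurable M hM hslab x₀
  simpa only [ofReal_norm] using h

/-- **`planarCeilingImpliesHardy` — the idea card's first lemma `PlanarCeilingImpliesHardy`, closed
form** (its `planarEnergy` / `hardyEnergy` unfolded): planar energies `≤ M` through every plane ⇒
Hardy energy `≤ 2M` at every centre, for every continuous field on `ℝ³`. [folklore] -/
theorem planarCeilingImpliesHardy : ∀ (w : EuclideanSpace ℝ (Fin 3) → EuclideanSpace ℝ (Fin 3)), Continuous w → ∀ M : ℝ, 0 ≤ M → (∀ (R : EuclideanSpace ℝ (Fin 3) ≃ₗᵢ[ℝ] EuclideanSpace ℝ (Fin 3)) (c : ℝ), ∫⁻ y : EuclideanSpace ℝ (Fin 2), ‖w (R (WithLp.toLp 2 ![y 0, y 1, c]))‖ₑ ^ 2 ≤ ENNReal.ofReal M) → ∀ x₀ : EuclideanSpace ℝ (Fin 3), ∫⁻ y, ‖w y‖ₑ ^ 2 / ‖y - x₀‖ₑ ≤ ENNReal.ofReal (2 * M) :=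
  fun _ hw _ hM hpl x₀ => hardyCeiling_of_planarCeiling hw hM hpl x₀

/-- **Hardy ceiling ⇒ scaled-energy ceiling** (the calibration `GlobalHardyCeiling ⟹ Type I in
energy` of the card): `∫_{B_r(x₀)} |w|² ≤ r · ∫ |w|²/|y − x₀|` for every `r > 0`. -/
theorem lintegral_ball_le_of_hardy {w : EuclideanSpace ℝ (Fin 3) → EuclideanSpace ℝ (Fin 3)}
    (x₀ : EuclideanSpace ℝ (Fin 3)) {r : ℝ} (hr : 0 < r) :
    ∫⁻ y in ball x₀ r, ‖w y‖ₑ ^ 2 ≤ ENNReal.ofReal r * ∫⁻ y, ‖w y‖ₑ ^ 2 / ‖y - x₀‖ₑ := by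
  have hr0 : ENNReal.ofReal r ≠ 0 := by simpa using hr
  calc ∫⁻ y in ball x₀ r, ‖w y‖ₑ ^ 2
      ≤ ∫⁻ y in ball x₀ r, ENNReal.ofReal r * (‖w y‖ₑ ^ 2 / ‖y - x₀‖ₑ) := by
        refine setLIntegral_mono' measurableSet_ball fun y hy => ?_
        rw [mem_ball, dist_eq_norm] at hy
        by_cases h0 : y = x₀
        · subst h0
          by_cases hw0 : ‖w y‖ₑ ^ 2 = 0
          · simp [hw0]
          · rw [sub_self, enorm_zero, ENNReal.div_zero hw0, ENNReal.mul_top hr0]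
            exact le_top
        · have hne0 : ‖y - x₀‖ₑ ≠ 0 := by simpa [sub_eq_zero] using h0
          calc ‖w y‖ₑ ^ 2 = ‖w y‖ₑ ^ 2 / ‖y - x₀‖ₑ * ‖y - x₀‖ₑ :=
                (ENNReal.div_mul_cancel hne0 enorm_ne_top).symm
            _ ≤ ‖w y‖ₑ ^ 2 / ‖y - x₀‖ₑ * ENNReal.ofReal r := by
                gcongr
                rw [← ofReal_norm]
                exact ENNReal.ofReal_le_ofReal hy.le
            _ = ENNReal.ofReal r * (‖w y‖ₑ ^ 2 / ‖y - x₀‖ₑ) := mul_comm _ _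
    _ = ENNReal.ofReal r * ∫⁻ y in ball x₀ r, ‖w y‖ₑ ^ 2 / ‖y - x₀‖ₑ := by
        rw [lintegral_const_mul' _ _ ENNReal.ofReal_ne_top]
    _ ≤ ENNReal.ofReal r * ∫⁻ y, ‖w y‖ₑ ^ 2 / ‖y - x₀‖ₑ := by
        gcongr
        exact Measure.restrict_le_self

/-! ## Along a solution -/

variable {ν T : ℝ} {u : ℝ → EuclideanSpace ℝ (Fin 3) → EuclideanSpace ℝ (Fin 3)}
  {p : ℝ → EuclideanSpace ℝ (Fin 3) → ℝ}

/-- **A planar bound along a classical solution is a Hardy bound.** If the planar energies of a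
classical solution on `[0,T)` are `≤ M` (all `t < T`, `R`, `c`), then its Hardy energies are
`≤ 2 max(M,0)` at every centre and every `t < T`. -/
theorem hardyCeiling_of_planarBound (hcl : IsClassicalNSSolutionOn (Ico 0 T) ν 0 u p) {M : ℝ}
    (hM : ∀ t ∈ Ico 0 T, ∀ (R : EuclideanSpace ℝ (Fin 3) ≃ₗᵢ[ℝ] EuclideanSpace ℝ (Fin 3)) (c : ℝ),
      ∫⁻ y : EuclideanSpace ℝ (Fin 2), ‖u t (R (toLp 2 ![y 0, y 1, c]))‖ₑ ^ 2 ≤ ENNReal.ofReal M) :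
    ∀ t ∈ Ico 0 T, ∀ x₀ : EuclideanSpace ℝ (Fin 3),
      ∫⁻ y, ‖u t y‖ₑ ^ 2 / ‖y - x₀‖ₑ ≤ ENNReal.ofReal (2 * max M 0) := by
  intro t ht x₀
  have hcont : Continuous (u t) := (hcl.contDiff_velocity ht).continuous
  have hM' : ∀ (R : EuclideanSpace ℝ (Fin 3) ≃ₗᵢ[ℝ] EuclideanSpace ℝ (Fin 3)) (c : ℝ),
      ∫⁻ y : EuclideanSpace ℝ (Fin 2), ‖u t (R (toLp 2 ![y 0, y 1, c]))‖ₑ ^ 2 ≤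
        ENNReal.ofReal (max M 0) :=
    fun R c => (hM t ht R c).trans (ENNReal.ofReal_le_ofReal (le_max_left _ _))
  exact hardyCeiling_of_planarCeiling hcont (le_max_right _ _) hM' x₀

/-- **GIVEN the crux, a global Hardy ceiling** (the idea card's stub A `GlobalHardyCeiling` follows
from `PlanarEnergyAPriori`; calibration against route HardyPointSink): every classical Leray–Hopf
solution from a rapidly decaying datum on `[0,T)` has `sup_{t<T} sup_{x₀} ∫|u(t,y)|²/|y−x₀| dy < ∞`. -/
theorem PlanarEnergyAPriori.globalHardyCeiling
    (hcrux : Summit.NavierStokesRegularity.NavierStokesRegularity.Theses.PlaneEnergyCeiling.PlanarEnergyAPriori)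
    (hν : 0 < ν) (hT : 0 < T) (hcl : IsClassicalNSSolutionOn (Ico 0 T) ν 0 u p)
    (hLH : IsLerayHopfOn T ν 0 (u 0) u) (hdec : HasRapidSpatialDecay (u 0)) :
    ∃ K : ℝ, 0 ≤ K ∧ ∀ t ∈ Ico 0 T, ∀ x₀ : EuclideanSpace ℝ (Fin 3),
      ∫⁻ y, ‖u t y‖ₑ ^ 2 / ‖y - x₀‖ₑ ≤ ENNReal.ofReal K := by
  obtain ⟨M, hM⟩ := hcrux ν T hν hT u p hcl hLH hdec
  exact ⟨2 * max M 0, by positivity, hardyCeiling_of_planarBound hcl hM⟩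

/-- **`globalHardyCeiling_of_planarEnergyAPriori`, registered form** (sub-goal of
stmt-NavierStokesRegularity-16855; the Sketch's `globalHardyCeiling_of_crux` with its kinematic
hypothesis discharged and `hardyEnergy` unfolded): `PlanarEnergyAPriori ⟹ GlobalHardyCeiling`. -/
theorem globalHardyCeiling_of_planarEnergyAPriori : Summit.NavierStokesRegularity.NavierStokesRegularity.Theses.PlaneEnergyCeiling.PlanarEnergyAPriori → ∀ (ν T : ℝ), 0 < ν → 0 < T → ∀ (u : ℝ → EuclideanSpace ℝ (Fin 3) → EuclideanSpace ℝ (Fin 3)) (p : ℝ → EuclideanSpace ℝ (Fin 3) → ℝ), Literature.Analysis.FluidPDE.IsClassicalNSSolutionOn (Set.Ico 0 T) ν 0 u p → Literature.Analysis.FluidPDE.IsLerayHopfOn T ν 0 (u 0) u → Literature.Analysis.FluidPDE.HasRapidSpatialDecay (u 0) → ∃ K : ℝ, ∀ t ∈ Set.Ico 0 T, ∀ x₀ : EuclideanSpace ℝ (Fin 3), ∫⁻ y, ‖u t y‖ₑ ^ 2 / ‖y - x₀‖ₑ ≤ ENNReal.ofReal K := by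
  intro hcrux ν T hν hT u p hcl hLH hdec
  obtain ⟨K, -, hK⟩ := PlanarEnergyAPriori.globalHardyCeiling hcrux hν hT hcl hLH hdec
  exact ⟨K, hK⟩

end Summit.NavierStokesRegularity.NavierStokesRegularity.Theorems.PlanarEnergyAPriori

end
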